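import Literature.AlgebraicGeometry.HodgeTheory.LimitMixedHodgeStructureRelativeHomGr
import HarnessLib

/-!
# Where the finite weight filtrations `W^f(L₁ ⊗ L₂)` and `W^f Hom(L₁, L₂)` jump

Topic `Literature/AlgebraicGeometry/HodgeTheory` (namespace `Literature.AlgebraicGeometry.HodgeTheory`). A theorem-only
sequel to `LimitMixedHodgeStructureRelativeTensorGrHodgeNumbers.lean` (Deligne's isomorphism of MHS
`⊕_{i+j=n} Gr^{W^f₁}_i L₁ ⊗ Gr^{W^f₂}_j L₂ ≅ Gr^{W^f}_n(L₁ ⊗ L₂)`, `subsingleton_gr`, `finrank_tensor_gr`) and to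
`LimitMixedHodgeStructureRelativeHomGr.lean` (El Zein's isomorphism of limit MHS
`Gr^{W^f}_n Hom(L₁, L₂) ≅ ⊕_i Hom(Gr^{W^f₁}_i L₁, Gr^{W^f₂}_{i+n} L₂)`, `apply_mem_wf_pred_of_homGrLift_eq_zero`,
`finrank_hom_gr`, `hodgeNumber_hom_gr`) for the relative limit mixed Hodge structures
(`RelativeLimitMixedHodgeStructure`: a MHS with a finite filtration `W^f` by sub-MHS, a nilpotent `N` and
`W = M(N, W^f)` — Kashiwara's infinitesimal mixed Hodge modules with one `N`) of the tree: the SUPPORT of the gradings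
`Gr^{W^f}_•(L₁ ⊗ L₂)` and `Gr^{W^f}_• Hom(L₁, L₂)` in terms of the supports of `Gr^{W^f₁}_• L₁`, `Gr^{W^f₂}_• L₂`.
No definition, no named fact.

PRINTED SOURCES, VERBATIM.
* M. Kashiwara, *A study of variation of mixed Hodge structure*, Publ. RIMS 22 (1986), §4.2–§4.3 (p. 1007): a pre-IMHM
  has «`(Gr^W_k, F(Gr^W_k), F̄(Gr^W_k); N₁, …, N_l)` is a nilpotent orbit of weight `k` for any `k`» and «their tensor
  products … their inner-Hom … are also pre-IMHM's» — with the filtrations `W ⊗ W′` («`(W ⊗ W′)_n = Σ_{i+j=n} W_i ⊗ W′_j`»)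
  and `Hom(W, W′)`.
* E. Cattani et al. (eds.), *Hodge Theory* (Math. Notes 49), §3.2.1.6 (p0154): «`F^k(A ⊗ B) = Σ_m F^m(A) ⊗ F^{k−m}(B)`»,
  «`F^k Hom(A, B) = {f : A → B : ∀ n, f(F^n(A)) ⊂ F^{n+k}(B)}`»; Prop. 3.2.19 (Hodge numbers); Thm. 8.2.1 (ii).
* P. Deligne, *Théorie de Hodge II*, 1.1.12; F. El Zein, *Mixed Hodge structures* (1983), §II.0.2.

THIS FILE (all proved).
* §1 `wf_eq_wf_pred_of_subsingleton_gr`, **`subsingleton_gr_iff`**: `Gr^{W^f}_k L = 0 ↔ W^f_k = W^f_{k−1}`.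
* §2 **`tensor_wf_eq_wf_pred_of`** ∕ `subsingleton_tensor_gr`: `Gr^{W^f}_n(L₁ ⊗ L₂) = 0` unless `n = i + j` with
  `Gr_i L₁ ≠ 0 ≠ Gr_j L₂`; **`exists_add_eq_of_tensor_wf_ne`**: the jumps of `W^f(L₁ ⊗ L₂)` are sums `i + j` of a jump `i`
  of `W^f₁` and a jump `j` of `W^f₂`; `hodgeNumber_tensor_gr_eq_zero_of`.
* §3 **`hom_wf_eq_wf_pred_of`** ∕ `subsingleton_hom_gr`: `Gr^{W^f}_n Hom(L₁, L₂) = 0` unless `n = j − i` with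
  `Gr_i L₁ ≠ 0 ≠ Gr_j L₂`; **`exists_sub_eq_of_hom_wf_ne`**: the jumps of `W^f Hom(L₁, L₂)` are differences `j − i`;
  `hodgeNumber_hom_gr_eq_zero_of`, and the type-by-type vanishing criterion **`hodgeNumber_hom_gr_eq_zero`**
  (`h^{p,q}(Gr_n Hom(L₁, L₂)) = 0` as soon as for every `i ∈ s` and all `a`, `b` one of `h^{−a,−b}(Gr_i L₁)`,
  `h^{p−a,q−b}(Gr_{i+n} L₂)` vanishes).

## References

* [Kashiwara1986] M. Kashiwara, *A study of variation of mixed Hodge structure*, Publ. RIMS 22 (1986): §4.2–§4.3 (p. 1007).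
* [CattaniElZeinGriffithsLe2014] E. Cattani et al. (eds.), *Hodge Theory*, Math. Notes 49 (2014): §3.2.1.6 (p0154),
  Prop. 3.2.19, Thm. 8.2.1 (ii).
* [DeligneHodgeII1971] P. Deligne, *Théorie de Hodge II*, Publ. Math. IHÉS 40 (1971): 1.1.12.
* [Elzein1983] F. El Zein, *Mixed Hodge structures*, Trans. AMS 275 (1983): §II.0.2.
-/

noncomputable section

open scoped TensorProduct

open Module

universe u v

namespace Literature.AlgebraicGeometry.HodgeTheory

open Motives Motives.MixedHodgeStructure

namespace RelativeLimitMixedHodgeStructure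

variable {V : Type u} [AddCommGroup V] [Module ℚ V] [FiniteDimensional ℚ V]
variable {V' : Type v} [AddCommGroup V'] [Module ℚ V'] [FiniteDimensional ℚ V']

/-! ## §1 `Gr^{W^f}_k L = 0 ↔ W^f_k = W^f_{k−1}` -/

omit [FiniteDimensional ℚ V] in
/-- **`W^f_k = W^f_{k−1}` when `Gr^{W^f}_k L = 0`** (converse of `subsingleton_gr`). [cite: CattaniElZeinGriffithsLe2014, Thm. 8.2.1 (ii)] -/
theorem wf_eq_wf_pred_of_subsingleton_gr (L : RelativeLimitMixedHodgeStructure V) {k : ℤ}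
    (h : Subsingleton (↥(L.wf k) ⧸ (L.wf (k - 1)).submoduleOf (L.wf k))) : L.wf k = L.wf (k - 1) := by
  refine le_antisymm (fun x hx => ?_) (L.monotone_wf (by omega))
  have h0 : (Submodule.Quotient.mk ⟨x, hx⟩ : ↥(L.wf k) ⧸ (L.wf (k - 1)).submoduleOf (L.wf k)) = 0 :=
    Subsingleton.elim _ _
  exact (Submodule.Quotient.mk_eq_zero ((L.wf (k - 1)).submoduleOf (L.wf k))).1 h0

omit [FiniteDimensional ℚ V] in
/-- **`Gr^{W^f}_k L = 0 ↔ W^f_k = W^f_{k−1}`.** [cite: CattaniElZeinGriffithsLe2014, Thm. 8.2.1 (ii)] -/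
theorem subsingleton_gr_iff (L : RelativeLimitMixedHodgeStructure V) (k : ℤ) :
    Subsingleton (↥(L.wf k) ⧸ (L.wf (k - 1)).submoduleOf (L.wf k)) ↔ L.wf k = L.wf (k - 1) :=
  ⟨L.wf_eq_wf_pred_of_subsingleton_gr, L.subsingleton_gr⟩

variable (L₁ : RelativeLimitMixedHodgeStructure V) (L₂ : RelativeLimitMixedHodgeStructure V')

/-! ## §2 The jumps of `W^f(L₁ ⊗ L₂)` are sums of jumps -/

/-- **`W^f_n(L₁ ⊗ L₂) = W^f_{n−1}(L₁ ⊗ L₂)` unless `n = i + j` with `W^f₁_i ≠ W^f₁_{i−1}` and `W^f₂_j ≠ W^f₂_{j−1}`**: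
each summand `W^f₁_i ⊗ W^f₂_j` (`i + j = n`) of `W^f_n(L₁ ⊗ L₂) = Σ_{i+j=n} W^f₁_i ⊗ W^f₂_j` already lies in
`W^f_{n−1}(L₁ ⊗ L₂)` because one of its factors equals its predecessor. [cite: Kashiwara1986, §4.2–§4.3 (p. 1007)]
[cite: CattaniElZeinGriffithsLe2014, §3.2.1.6 (p0154)] -/
theorem tensor_wf_eq_wf_pred_of (n : ℤ)
    (h : ∀ i j : ℤ, i + j = n → L₁.wf i ≠ L₁.wf (i - 1) → L₂.wf j = L₂.wf (j - 1)) :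
    (L₁.tensor L₂).wf n = (L₁.tensor L₂).wf (n - 1) := by
  refine le_antisymm ?_ ((L₁.tensor L₂).monotone_wf (by omega))
  rw [tensor_wf]
  refine iSup₂_le fun ij (hij : ij.1 + ij.2 = n) => ?_
  by_cases hi : L₁.wf ij.1 = L₁.wf (ij.1 - 1)
  · rw [hi]
    exact L₁.map₂_wf_le_tensor_wf L₂ (show (ij.1 - 1) + ij.2 = n - 1 by omega)
  · rw [h ij.1 ij.2 hij hi]
    exact L₁.map₂_wf_le_tensor_wf L₂ (show ij.1 + (ij.2 - 1) = n - 1 by omega)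

/-- **`Gr^{W^f}_n(L₁ ⊗ L₂) = 0` unless `n = i + j` with `Gr_i L₁ ≠ 0 ≠ Gr_j L₂`.** [cite: Kashiwara1986, §4.2–§4.3 (p. 1007)]
[cite: DeligneHodgeII1971, 1.1.12] -/
theorem subsingleton_tensor_gr (n : ℤ)
    (h : ∀ i j : ℤ, i + j = n → L₁.wf i ≠ L₁.wf (i - 1) → L₂.wf j = L₂.wf (j - 1)) :
    Subsingleton (↥((L₁.tensor L₂).wf n) ⧸ ((L₁.tensor L₂).wf (n - 1)).submoduleOf ((L₁.tensor L₂).wf n)) :=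
  (L₁.tensor L₂).subsingleton_gr (L₁.tensor_wf_eq_wf_pred_of L₂ n h)

/-- **The jumps of `W^f(L₁ ⊗ L₂)` are sums of jumps of `W^f₁` and `W^f₂`**: if `W^f_n(L₁ ⊗ L₂) ≠ W^f_{n−1}(L₁ ⊗ L₂)`
then `n = i + j` for some `i`, `j` with `W^f₁_i ≠ W^f₁_{i−1}` and `W^f₂_j ≠ W^f₂_{j−1}`.
[cite: Kashiwara1986, §4.2–§4.3 (p. 1007)] [cite: CattaniElZeinGriffithsLe2014, §3.2.1.6 (p0154)] -/
theorem exists_add_eq_of_tensor_wf_ne (n : ℤ) (hn : (L₁.tensor L₂).wf n ≠ (L₁.tensor L₂).wf (n - 1)) :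
    ∃ i j : ℤ, i + j = n ∧ L₁.wf i ≠ L₁.wf (i - 1) ∧ L₂.wf j ≠ L₂.wf (j - 1) := by
  by_contra hne
  push Not at hne
  exact hn (L₁.tensor_wf_eq_wf_pred_of L₂ n fun i j hij hi => hne i j hij hi)

/-- **`h^{p,q}(Gr^{W^f}_n(L₁ ⊗ L₂)) = 0` for every `(p, q)` unless `n` is a sum of jumps.** [cite: CattaniElZeinGriffithsLe2014, Prop. 3.2.19] -/
theorem hodgeNumber_tensor_gr_eq_zero_of (n : ℤ)
    (h : ∀ i j : ℤ, i + j = n → L₁.wf i ≠ L₁.wf (i - 1) → L₂.wf j = L₂.wf (j - 1)) (p q : ℤ) :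
    ((L₁.tensor L₂).gr n).toMixedHodgeStructure.hodgeNumber p q = 0 :=
  (L₁.tensor L₂).hodgeNumber_gr_eq_zero_of_wf_eq (L₁.tensor_wf_eq_wf_pred_of L₂ n h) p q

/-! ## §3 The jumps of `W^f Hom(L₁, L₂)` are differences of jumps -/

/-- **`W^f_n Hom(L₁, L₂) = W^f_{n−1} Hom(L₁, L₂)` unless `n = j − i` with `W^f₁_i ≠ W^f₁_{i−1}` and `W^f₂_j ≠ W^f₂_{j−1}`**:
if for every jump `i` of `W^f₁` one has `W^f₂_{i+n} = W^f₂_{i+n−1}`, then every `f` with `f(W^f₁_k) ⊆ W^f₂_{k+n}` for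
all `k` satisfies `f(W^f₁_k) ⊆ W^f₂_{k+n−1}` for all `k` (all graded components `Gr_i f : Gr_i L₁ → Gr_{i+n} L₂`
vanish, one of the two sides being zero; then `apply_mem_wf_pred_of_homGrLift_eq_zero`).
[cite: Kashiwara1986, §4.3 (p. 1007)] [cite: Elzein1983, §II.0.2] [cite: CattaniElZeinGriffithsLe2014, §3.2.1.6 (p0154)] -/
theorem hom_wf_eq_wf_pred_of (n : ℤ) (h : ∀ i : ℤ, L₁.wf i ≠ L₁.wf (i - 1) → L₂.wf (i + n) = L₂.wf (i + n - 1)) :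
    (L₁.hom L₂).wf n = (L₁.hom L₂).wf (n - 1) := by
  obtain ⟨s, hcov⟩ := L₁.exists_covering_finset_left
  refine le_antisymm (fun f hf => ?_) ((L₁.hom L₂).monotone_wf (by omega))
  have hf0 : ∀ i : ↥s, L₁.homGrLift L₂ n i.1 (i.1 + n) rfl ⟨f, hf⟩ = 0 := fun i => by
    by_cases hi : L₁.wf i.1 = L₁.wf (i.1 - 1)
    · haveI := L₁.subsingleton_gr hi
      exact LinearMap.ext fun q => by rw [Subsingleton.elim q 0, map_zero, LinearMap.zero_apply]
    · haveI := L₂.subsingleton_gr (h i.1 hi)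
      exact LinearMap.ext fun q => Subsingleton.elim _ _
  rw [mem_hom_wf_iff]
  intro k x hx
  exact L₁.apply_mem_wf_pred_of_homGrLift_eq_zero L₂ n s hcov ⟨f, hf⟩ hf0 k hx

/-- **`Gr^{W^f}_n Hom(L₁, L₂) = 0` unless `n = j − i` with `Gr_i L₁ ≠ 0 ≠ Gr_j L₂`.** [cite: Elzein1983, §II.0.2]
[cite: Kashiwara1986, §4.3 (p. 1007)] -/
theorem subsingleton_hom_gr (n : ℤ) (h : ∀ i : ℤ, L₁.wf i ≠ L₁.wf (i - 1) → L₂.wf (i + n) = L₂.wf (i + n - 1)) :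
    Subsingleton (↥((L₁.hom L₂).wf n) ⧸ ((L₁.hom L₂).wf (n - 1)).submoduleOf ((L₁.hom L₂).wf n)) :=
  (L₁.hom L₂).subsingleton_gr (L₁.hom_wf_eq_wf_pred_of L₂ n h)

/-- **The jumps of `W^f Hom(L₁, L₂)` are differences of jumps of `W^f₂` and `W^f₁`**: if
`W^f_n Hom(L₁, L₂) ≠ W^f_{n−1} Hom(L₁, L₂)` then `n = j − i` for some jump `i` of `W^f₁` and some jump `j` of `W^f₂`.
[cite: Elzein1983, §II.0.2] [cite: Kashiwara1986, §4.3 (p. 1007)] -/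
theorem exists_sub_eq_of_hom_wf_ne (n : ℤ) (hn : (L₁.hom L₂).wf n ≠ (L₁.hom L₂).wf (n - 1)) :
    ∃ i j : ℤ, j - i = n ∧ L₁.wf i ≠ L₁.wf (i - 1) ∧ L₂.wf j ≠ L₂.wf (j - 1) := by
  by_contra hne
  push Not at hne
  exact hn (L₁.hom_wf_eq_wf_pred_of L₂ n fun i hi => hne i (i + n) (by omega) hi)

/-- **`h^{p,q}(Gr^{W^f}_n Hom(L₁, L₂)) = 0` for every `(p, q)` unless `n` is a difference of jumps.**
[cite: CattaniElZeinGriffithsLe2014, Prop. 3.2.19] -/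
theorem hodgeNumber_hom_gr_eq_zero_of (n : ℤ)
    (h : ∀ i : ℤ, L₁.wf i ≠ L₁.wf (i - 1) → L₂.wf (i + n) = L₂.wf (i + n - 1)) (p q : ℤ) :
    ((L₁.hom L₂).gr n).toMixedHodgeStructure.hodgeNumber p q = 0 :=
  (L₁.hom L₂).hodgeNumber_gr_eq_zero_of_wf_eq (L₁.hom_wf_eq_wf_pred_of L₂ n h) p q

/-- **Hodge numbers of `Gr^{W^f}_n Hom(L₁, L₂)` vanish outside the summed types**: if for every `i ∈ s` (`s` covering the
support of `Gr L₁`) and all `a`, `b` one of `h^{−a,−b}(Gr_i L₁)`, `h^{p−a,q−b}(Gr_{i+n} L₂)` is zero, then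
`h^{p,q}(Gr_n Hom(L₁, L₂)) = 0`. [cite: CattaniElZeinGriffithsLe2014, Prop. 3.2.19 and §3.2.2.7] [cite: Elzein1983, §II.0.2] -/
theorem hodgeNumber_hom_gr_eq_zero (n : ℤ) (s : Finset ℤ) (hcov : ∀ i : ℤ, L₁.wf i ≠ L₁.wf (i - 1) → i ∈ s) (p q : ℤ)
    (h0 : ∀ i ∈ s, ∀ a b : ℤ,
      (L₁.gr i).toMixedHodgeStructure.hodgeNumber (-a) (-b) = 0 ∨
        (L₂.gr (i + n)).toMixedHodgeStructure.hodgeNumber (p - a) (q - b) = 0) :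
    ((L₁.hom L₂).gr n).toMixedHodgeStructure.hodgeNumber p q = 0 := by
  rw [L₁.hodgeNumber_hom_gr L₂ n s hcov p q]
  refine Finset.sum_eq_zero fun i hi => ?_
  refine finsum_eq_zero_of_forall_eq_zero fun a => finsum_eq_zero_of_forall_eq_zero fun b => ?_
  rcases h0 i hi a b with h | h
  · rw [h, zero_mul]
  · rw [h, mul_zero]

/-- **`dim Gr^{W^f}_n Hom(L₁, L₂) = 0 ↔` no `i ∈ s` has both `Gr_i L₁ ≠ 0` and `Gr_{i+n} L₂ ≠ 0`** (`s` covering the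
support of `Gr L₁`). [cite: Elzein1983, §II.0.2] -/
theorem finrank_hom_gr_eq_zero_iff (n : ℤ) (s : Finset ℤ) (hcov : ∀ i : ℤ, L₁.wf i ≠ L₁.wf (i - 1) → i ∈ s) :
    finrank ℚ (↥((L₁.hom L₂).wf n) ⧸ ((L₁.hom L₂).wf (n - 1)).submoduleOf ((L₁.hom L₂).wf n)) = 0 ↔
      ∀ i ∈ s, finrank ℚ (↥(L₁.wf i) ⧸ (L₁.wf (i - 1)).submoduleOf (L₁.wf i)) = 0 ∨
        finrank ℚ (↥(L₂.wf (i + n)) ⧸ (L₂.wf (i + n - 1)).submoduleOf (L₂.wf (i + n))) = 0 := by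
  rw [L₁.finrank_hom_gr L₂ n s hcov, Finset.sum_eq_zero_iff]
  exact forall₂_congr fun i _ => mul_eq_zero

end RelativeLimitMixedHodgeStructure

end Literature.AlgebraicGeometry.HodgeTheory
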